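import Literature.NumberTheory.Rogawski1990.ArchTransfFamilyJumpJets      -- PART 3a (LH7-p02 (g2)): `bzAdaptedVec`∕`bzCayVec` letters; brings ★ Resolved (`Ũ_k`), ★ (COORD) `cayPt`, `archERho`
import Literature.Analysis.Calculus.IteratedFDerivExpLinear               -- ★ p850381 (F0P3a-p09 (g5)) (EXP-JET): `iteratedFDeriv_const_mul_cexp_ofReal_mul_I_apply`
import HarnessLib

/-!
# (I₃) for the candidate transfer family — PART 3c (UNIT JETS): the twisted prefactor `archERho_S · Ũ_k` is `exp(iΛ_S)` with `Λ_S` LINEAR; its jets on the adapted letters at a wall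
# point EQUAL the jets of `archERho_{S″} · Ũ_k^{S″}` on the Cayley letters at the Cayley point (Rogawski 1990 §4.9, §8.2; Shelstad 1979 §4 Lemma 4.3)

Topic `NumberTheory/Rogawski1990`; namespace `Literature.NumberTheory.Rogawski1990`.  THEOREMS ONLY (no `def`, no instance, no notation, no axiom, no named fact, no `sorry`).
Cell `pub/hodgecm-mathlib`, line LH3 (closer stub `stub_N9`, crux H413 = `stmt-HodgeConjecture-24833`), organ **O-L2 (I₃-TRANSF)**, ED. 3 brick (W2) of the (P) half
(LH3-plan (g3) 2026-09-02T07:53Z; author LH7-p02 (g2)).  HONEST LABEL: HC_CM is proved only modulo the 7 printed citations (2 remaining: hLiu418 = `stmt-HodgeConjecture-24832`,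
h413 = `stmt-HodgeConjecture-24833`) until rung 0 closes; count-neutral.

THE MATHEMATICS.  In ★ `bzTwistedDeriv` the `H`-side twist `archERho S` multiplies ★ LH3-p04's resolved form `transfFam S = w_S·Ũ_k·Σ_ρ κ_ρ·'F_S∘ρ`; the smooth prefactor of the
partner sum is therefore `U_S := archERho S · Ũ_k^S`.  §1: `U_S(c) = exp(i Λ_S(c))` with the LINEAR phase `Λ_S(c) = Σ_{w ∉ S} (k_w + ½)(c_{w0} + c_{w2}) + Σ_{w ∈ S} (2k_w + 1) c_{w2}`
(at a compact place `(E₀E₂)^k E₂ · e^{i(θ₀−θ₂)∕2} = e^{i(k+½)(θ₀+θ₂)}` — the half-sum twist makes the prefactor a function of `θ₀ + θ₂` ALONE), so by ★ (EXP-JET)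
`Dʳ(K·U_S)(x)(m) = K·U_S(x)·Π_i (iΛ_S(m_i))`.  §2: `Λ_S` on one-place vectors; `Λ_S(bzAdaptedVec w₀ l) = Λ_{S″}(bzCayVec l)` for EVERY letter (`S″ = insert w₀ S`, `w₀ ∉ S`: normal
`e₀ − e₂ ↦ 0 = Λ_{S″}(∂_x)`, tangential `e₀ + e₂ ↦ 2k+1 = Λ_{S″}(∂_θ)`, third `e₁ ↦ 0`, other places untouched) and `Λ_S(p) = Λ_{S″}(cayPt w₀ p)` on the wall `p_{w₀0} = p_{w₀2}`.
§3: hence **`Dʳ(K·U_S)(p)(bzAdaptedVec∘u) = Dʳ(K·U_{S″})(cayPt w₀ p)(bzCayVec∘u)`** for every word `u`, and `Dʳ(K·U_{S″})(x)(bzCayVec∘u) = 0` as soon as `u` has a normal letter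
(`Λ_{S″}(∂_x) = 0`) — the two facts PART 3d's Leibniz assembly matches term by term.

## References
* [Rogawski1990] J. D. Rogawski, *Automorphic Representations of Unitary Groups in Three Variables* (1990), §4.9 p. 55, §8.2 p. 119.
* [Shelstad1979] D. Shelstad, *Characters and inner forms of a quasi-split group over ℝ*, Compositio Math. 39 (1979), §4 p. 24 (`e^{ρ}`), Lemma 4.3 p. 25.
* [Bouaziz1994IntegralesOrbitales] A. Bouaziz, *Intégrales orbitales sur les groupes de Lie réductifs*, Ann. Sci. ÉNS 27 (1994), §6.2 p. 591 (`r_Ψ`).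
-/

set_option autoImplicit false

noncomputable section

open NumberField NumberField.InfinitePlace Complex Set Filter Topology Equiv Finset
open scoped Classical Real ContDiff
open Literature.NumberTheory.Automorphic Literature.NumberTheory.Automorphic.UnitaryGroup Literature.NumberTheory.Automorphic.ArchCartan
open Literature.NumberTheory.GaloisRepresentations
open Literature.Analysis.Calculus

namespace Literature.NumberTheory.Rogawski1990

variable {W : Type*} [Fintype W] [DecidableEq W]

/-! ## §1 `archERho_S · Ũ_k = exp(iΛ_S)` with `Λ_S` linear; the jets -/

section Phase

/-- **The twisted prefactor is the exponential of a LINEAR phase**: `archERho S c · Ũ_k(c) = exp(i·Σ_w λ_w(c))`, `λ_w(c) = (k_w+½)(c_{w0}+c_{w2})` (compact `w ∉ S`),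
`(2k_w+1)c_{w2}` (split `w ∈ S`). [cite: Rogawski1990, §4.9 p. 55] [cite: Shelstad1979, §4 p. 24] -/
theorem archERho_mul_unit_eq_cexp (S : Finset W) (k : W → ℤ) (c : W → Fin 3 → ℝ) :
    archERho S c * ∏ w : W, (if w ∈ S then Complex.exp (((2 * k w + 1 : ℤ) : ℂ) * ((c w 2 : ℂ) * I))
        else (((Circle.exp (c w 0) : ℂ) * Circle.exp (c w 2)) ^ (k w)) * (Circle.exp (c w 2) : ℂ)) =
      Complex.exp (((∑ w : W, (if w ∈ S then (2 * (k w : ℝ) + 1) * c w 2 else ((k w : ℝ) + 2⁻¹) * (c w 0 + c w 2)) : ℝ) : ℂ) * I) := by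
  unfold archERho
  rw [← Finset.prod_mul_distrib, Complex.ofReal_sum, Finset.sum_mul, Complex.exp_sum]
  refine Finset.prod_congr rfl fun w _ => ?_
  by_cases hw : w ∈ S
  · rw [if_pos hw, if_pos hw, if_pos hw, one_mul]
    congr 1
    push_cast
    ring
  · rw [if_neg hw, if_neg hw, if_neg hw, Circle.coe_exp, Circle.coe_exp, Circle.coe_exp, ← Complex.exp_add, ← Complex.exp_int_mul, ← Complex.exp_add,
      ← Complex.exp_add]
    congr 1
    push_cast
    ring

/-- **The linear phase `Λ_S` as a continuous linear functional** on the coordinate space, with `archERho S · Ũ_k = exp(iΛ_S)`. [cite: Rogawski1990, §4.9 p. 55] -/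
theorem exists_clm_phase (S : Finset W) (k : W → ℤ) :
    ∃ Λ : (W → Fin 3 → ℝ) →L[ℝ] ℝ,
      (∀ c, Λ c = ∑ w : W, (if w ∈ S then (2 * (k w : ℝ) + 1) * c w 2 else ((k w : ℝ) + 2⁻¹) * (c w 0 + c w 2))) ∧
      ∀ c, archERho S c * ∏ w : W, (if w ∈ S then Complex.exp (((2 * k w + 1 : ℤ) : ℂ) * ((c w 2 : ℂ) * I))
          else (((Circle.exp (c w 0) : ℂ) * Circle.exp (c w 2)) ^ (k w)) * (Circle.exp (c w 2) : ℂ)) = Complex.exp ((Λ c : ℂ) * I) := by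
  let P : W → Fin 3 → ((W → Fin 3 → ℝ) →L[ℝ] ℝ) := fun w i =>
    (ContinuousLinearMap.proj (R := ℝ) (φ := fun _ : Fin 3 => ℝ) i).comp (ContinuousLinearMap.proj (R := ℝ) (φ := fun _ : W => Fin 3 → ℝ) w)
  have hP : ∀ w i c, P w i c = c w i := fun w i c => rfl
  have hΛ : ∀ c : W → Fin 3 → ℝ, (∑ w : W, (if w ∈ S then (2 * (k w : ℝ) + 1) • P w 2 else ((k w : ℝ) + 2⁻¹) • (P w 0 + P w 2))) c =
      ∑ w : W, (if w ∈ S then (2 * (k w : ℝ) + 1) * c w 2 else ((k w : ℝ) + 2⁻¹) * (c w 0 + c w 2)) := by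
    intro c
    simp only [FunLike.coe_sum, Finset.sum_apply]
    refine Finset.sum_congr rfl fun w _ => ?_
    by_cases hw : w ∈ S
    · rw [if_pos hw, if_pos hw, FunLike.coe_smul, Pi.smul_apply, hP, smul_eq_mul]
    · rw [if_neg hw, if_neg hw, FunLike.coe_smul, Pi.smul_apply, FunLike.coe_add, Pi.add_apply, hP, hP, smul_eq_mul]
  refine ⟨∑ w : W, (if w ∈ S then (2 * (k w : ℝ) + 1) • P w 2 else ((k w : ℝ) + 2⁻¹) • (P w 0 + P w 2)), hΛ, fun c => ?_⟩
  rw [archERho_mul_unit_eq_cexp, hΛ]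

/-- **JETS OF THE TWISTED PREFACTOR**: `Dʳ(K · archERho_S · Ũ_k)(x)(m) = K · exp(iΛ_S x) · Π_i (iΛ_S(m_i))` (★ EXP-JET). [cite: Rogawski1990, §4.9 p. 55] [cite: Shelstad1979, §4 p. 24] -/
theorem iteratedFDeriv_const_mul_archERho_mul_unit_apply (S : Finset W) (k : W → ℤ) (K : ℂ) (x : W → Fin 3 → ℝ) (n : ℕ) (m : Fin n → W → Fin 3 → ℝ) :
    iteratedFDeriv ℝ n (fun c : W → Fin 3 → ℝ => K * (archERho S c * ∏ w : W, (if w ∈ S then Complex.exp (((2 * k w + 1 : ℤ) : ℂ) * ((c w 2 : ℂ) * I))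
        else (((Circle.exp (c w 0) : ℂ) * Circle.exp (c w 2)) ^ (k w)) * (Circle.exp (c w 2) : ℂ)))) x m =
      K * Complex.exp (((∑ w : W, (if w ∈ S then (2 * (k w : ℝ) + 1) * x w 2 else ((k w : ℝ) + 2⁻¹) * (x w 0 + x w 2)) : ℝ) : ℂ) * I) *
        ∏ i, (((∑ w : W, (if w ∈ S then (2 * (k w : ℝ) + 1) * (m i) w 2 else ((k w : ℝ) + 2⁻¹) * ((m i) w 0 + (m i) w 2)) : ℝ) : ℂ) * I) := by
  obtain ⟨Λ, hΛ, hform⟩ := exists_clm_phase S k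
  have hfun : (fun c : W → Fin 3 → ℝ => K * (archERho S c * ∏ w : W, (if w ∈ S then Complex.exp (((2 * k w + 1 : ℤ) : ℂ) * ((c w 2 : ℂ) * I))
        else (((Circle.exp (c w 0) : ℂ) * Circle.exp (c w 2)) ^ (k w)) * (Circle.exp (c w 2) : ℂ)))) = fun c => K * Complex.exp ((Λ c : ℂ) * I) := by
    funext c; rw [hform]
  rw [hfun, iteratedFDeriv_const_mul_cexp_ofReal_mul_I_apply, hΛ]
  simp only [hΛ]

/-- The twisted prefactor is entire. [cite: Rogawski1990, §4.9 p. 55] -/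
theorem contDiff_const_mul_archERho_mul_unit (S : Finset W) (k : W → ℤ) (K : ℂ) :
    ContDiff ℝ ∞ (fun c : W → Fin 3 → ℝ => K * (archERho S c * ∏ w : W, (if w ∈ S then Complex.exp (((2 * k w + 1 : ℤ) : ℂ) * ((c w 2 : ℂ) * I))
        else (((Circle.exp (c w 0) : ℂ) * Circle.exp (c w 2)) ^ (k w)) * (Circle.exp (c w 2) : ℂ)))) := by
  obtain ⟨Λ, -, hform⟩ := exists_clm_phase S k
  have hfun : (fun c : W → Fin 3 → ℝ => K * (archERho S c * ∏ w : W, (if w ∈ S then Complex.exp (((2 * k w + 1 : ℤ) : ℂ) * ((c w 2 : ℂ) * I))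
        else (((Circle.exp (c w 0) : ℂ) * Circle.exp (c w 2)) ^ (k w)) * (Circle.exp (c w 2) : ℂ)))) = fun c => K * Complex.exp ((Λ c : ℂ) * I) := by
    funext c; rw [hform]
  rw [hfun]
  exact contDiff_const.mul (Complex.contDiff_exp.comp (((Complex.ofRealCLM.contDiff.comp Λ.contDiff)).mul contDiff_const))

end Phase

/-! ## §2 The phase on one-place vectors; the letters and the Cayley point -/

section Letters

/-- The phase on a one-place vector. [cite: Shelstad1979, Lemma 4.3 (p. 25)] -/
theorem phase_single (S : Finset W) (k : W → ℤ) (w : W) (v : Fin 3 → ℝ) :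
    (∑ w' : W, (if w' ∈ S then (2 * (k w' : ℝ) + 1) * (Pi.single w v : W → Fin 3 → ℝ) w' 2
        else ((k w' : ℝ) + 2⁻¹) * ((Pi.single w v : W → Fin 3 → ℝ) w' 0 + (Pi.single w v : W → Fin 3 → ℝ) w' 2))) =
      (if w ∈ S then (2 * (k w : ℝ) + 1) * v 2 else ((k w : ℝ) + 2⁻¹) * (v 0 + v 2)) := by
  rw [Finset.sum_eq_single w]
  · simp only [Pi.single_eq_same]
  · intro w' _ hw'
    simp only [Pi.single_eq_of_ne hw', Pi.zero_apply, mul_zero, add_zero, ite_self]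
  · intro h; exact absurd (Finset.mem_univ w) h

/-- **The phase agrees on the letters**: `Λ_S(bzAdaptedVec w₀ l) = Λ_{insert w₀ S}(bzCayVec l)` for every letter (`w₀ ∉ S`). [cite: Shelstad1979, Lemma 4.3 (p. 25)] -/
theorem phase_bzAdaptedVec_eq_phase_bzCayVec (S : Finset W) (k : W → ℤ) {w₀ : W} (hw₀ : w₀ ∉ S) (l : W × Fin 3) :
    (∑ w' : W, (if w' ∈ S then (2 * (k w' : ℝ) + 1) * (bzAdaptedVec w₀ l) w' 2 else ((k w' : ℝ) + 2⁻¹) * ((bzAdaptedVec w₀ l) w' 0 + (bzAdaptedVec w₀ l) w' 2))) =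
      ∑ w' : W, (if w' ∈ insert w₀ S then (2 * (k w' : ℝ) + 1) * (bzCayVec l : W → Fin 3 → ℝ) w' 2
        else ((k w' : ℝ) + 2⁻¹) * ((bzCayVec l : W → Fin 3 → ℝ) w' 0 + (bzCayVec l : W → Fin 3 → ℝ) w' 2)) := by
  obtain ⟨w, i⟩ := l
  by_cases hw : w = w₀
  · subst hw
    have hA : bzAdaptedVec w (w, i) = Pi.single w ((![![(1 : ℝ), 0, -1], ![0, 1, 0], ![1, 0, 1]] : Fin 3 → Fin 3 → ℝ) i) := by
      unfold bzAdaptedVec; rw [if_pos rfl]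
    have hC : (bzCayVec (w, i) : W → Fin 3 → ℝ) = Pi.single w (Pi.single i 1) := rfl
    rw [hA, hC, phase_single, phase_single, if_neg hw₀, if_pos (Finset.mem_insert_self w S)]
    fin_cases i
    · simp
    · simp
    · simp; ring
  · have hA : bzAdaptedVec w₀ (w, i) = Pi.single w (Pi.single i 1) := by unfold bzAdaptedVec; rw [if_neg hw]
    have hC : (bzCayVec (w, i) : W → Fin 3 → ℝ) = Pi.single w (Pi.single i 1) := rfl
    have hmem : (w ∈ insert w₀ S) ↔ (w ∈ S) := by simp [Finset.mem_insert, hw]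
    rw [hA, hC, phase_single, phase_single]
    simp only [hmem]

/-- **The phase agrees at the Cayley point**: on the wall `p_{w₀0} = p_{w₀2}` (`w₀ ∉ S`), `Λ_S(p) = Λ_{insert w₀ S}(cayPt w₀ p)` (both `w₀`-terms are `(2k+1)θ`).
[cite: Shelstad1979, §4 p. 25] [cite: Rogawski1990, §8.2 p. 119] -/
theorem phase_eq_phase_cayPt (S : Finset W) (k : W → ℤ) {w₀ : W} (hw₀ : w₀ ∉ S) {p : W → Fin 3 → ℝ} (hs02 : p w₀ 0 = p w₀ 2) :
    (∑ w' : W, (if w' ∈ S then (2 * (k w' : ℝ) + 1) * p w' 2 else ((k w' : ℝ) + 2⁻¹) * (p w' 0 + p w' 2))) =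
      ∑ w' : W, (if w' ∈ insert w₀ S then (2 * (k w' : ℝ) + 1) * (cayPt w₀ p) w' 2 else ((k w' : ℝ) + 2⁻¹) * ((cayPt w₀ p) w' 0 + (cayPt w₀ p) w' 2)) := by
  refine Finset.sum_congr rfl fun w' _ => ?_
  by_cases hw : w' = w₀
  · subst hw
    rw [if_neg hw₀, if_pos (Finset.mem_insert_self w' S), cayPt_apply_self]
    simp only [Matrix.cons_val_two, Matrix.tail_cons, Matrix.head_cons]
    rw [hs02]
    ring
  · have hmem : (w' ∈ insert w₀ S) ↔ (w' ∈ S) := by simp [Finset.mem_insert, hw]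
    simp only [hmem, cayPt_apply_of_ne hw]

/-- The twist `archERho` agrees at the Cayley point: `archERho S p = archERho (insert w₀ S) (cayPt w₀ p)` on the wall (both `w₀`-factors are `1`). [cite: Shelstad1979, §4 p. 24] -/
theorem archERho_eq_archERho_insert_cayPt (S : Finset W) {w₀ : W} (hw₀ : w₀ ∉ S) {p : W → Fin 3 → ℝ} (hs02 : p w₀ 0 = p w₀ 2) :
    archERho S p = archERho (insert w₀ S) (cayPt w₀ p) := by
  unfold archERho
  refine Finset.prod_congr rfl fun w' _ => ?_
  by_cases hw : w' = w₀
  · subst hw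
    rw [if_neg hw₀, if_pos (Finset.mem_insert_self w' S), hs02, sub_self, zero_div, Circle.exp_zero, Circle.coe_one]
  · have hmem : (w' ∈ insert w₀ S) ↔ (w' ∈ S) := by simp [Finset.mem_insert, hw]
    simp only [hmem, cayPt_apply_of_ne hw]

end Letters

/-! ## §3 The jets match across the Cayley transform; words with a normal letter are killed on the Cayley side -/

section Match

/-- **THE PREFACTOR JETS MATCH ACROSS THE CAYLEY TRANSFORM**: at a wall point `p` (`p_{w₀0} = p_{w₀2}`, `w₀ ∉ S`), for every word `u` of letters,
`Dʳ(K·archERho_S·Ũ^S_k)(p)(bzAdaptedVec w₀ ∘ u) = Dʳ(K·archERho_{S″}·Ũ^{S″}_k)(cayPt w₀ p)(bzCayVec ∘ u)`, `S″ = insert w₀ S`. [cite: Shelstad1979, Lemma 4.3 p. 25]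
[cite: Rogawski1990, §4.9 p. 55; §8.2 p. 119] -/
theorem iteratedFDeriv_prefactor_adapted_eq_cayley (S : Finset W) (k : W → ℤ) (K : ℂ) {w₀ : W} (hw₀ : w₀ ∉ S) {p : W → Fin 3 → ℝ} (hs02 : p w₀ 0 = p w₀ 2)
    (n : ℕ) (u : Fin n → W × Fin 3) :
    iteratedFDeriv ℝ n (fun c : W → Fin 3 → ℝ => K * (archERho S c * ∏ w : W, (if w ∈ S then Complex.exp (((2 * k w + 1 : ℤ) : ℂ) * ((c w 2 : ℂ) * I))
        else (((Circle.exp (c w 0) : ℂ) * Circle.exp (c w 2)) ^ (k w)) * (Circle.exp (c w 2) : ℂ)))) p (fun i => bzAdaptedVec w₀ (u i)) =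
      iteratedFDeriv ℝ n (fun c : W → Fin 3 → ℝ => K * (archERho (insert w₀ S) c * ∏ w : W, (if w ∈ insert w₀ S then Complex.exp (((2 * k w + 1 : ℤ) : ℂ) * ((c w 2 : ℂ) * I))
        else (((Circle.exp (c w 0) : ℂ) * Circle.exp (c w 2)) ^ (k w)) * (Circle.exp (c w 2) : ℂ)))) (cayPt w₀ p) (fun i => (bzCayVec (u i) : W → Fin 3 → ℝ)) := by
  rw [iteratedFDeriv_const_mul_archERho_mul_unit_apply, iteratedFDeriv_const_mul_archERho_mul_unit_apply, phase_eq_phase_cayPt S k hw₀ hs02]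
  congr 1
  exact Finset.prod_congr rfl fun i _ => by rw [phase_bzAdaptedVec_eq_phase_bzCayVec S k hw₀ (u i)]

/-- **A NORMAL LETTER KILLS THE CAYLEY-SIDE PREFACTOR JET**: for `w₀ ∈ S′`, `Λ_{S′}(∂_{x,w₀}) = 0`, so `Dʳ(K·archERho_{S′}·Ũ^{S′}_k)(x)(bzCayVec ∘ u) = 0` whenever some letter
of `u` is the normal letter `(w₀, 0)` (the prefactor does not depend on `x_{w₀}`). [cite: Shelstad1979, Lemma 4.3 p. 25] [cite: Rogawski1990, §8.2 p. 119] -/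
theorem iteratedFDeriv_prefactor_cayley_eq_zero_of_normal (S' : Finset W) (k : W → ℤ) (K : ℂ) {w₀ : W} (hw₀ : w₀ ∈ S') (x : W → Fin 3 → ℝ)
    {n : ℕ} {u : Fin n → W × Fin 3} {i : Fin n} (hi : u i = (w₀, 0)) :
    iteratedFDeriv ℝ n (fun c : W → Fin 3 → ℝ => K * (archERho S' c * ∏ w : W, (if w ∈ S' then Complex.exp (((2 * k w + 1 : ℤ) : ℂ) * ((c w 2 : ℂ) * I))
        else (((Circle.exp (c w 0) : ℂ) * Circle.exp (c w 2)) ^ (k w)) * (Circle.exp (c w 2) : ℂ)))) x (fun i => (bzCayVec (u i) : W → Fin 3 → ℝ)) = 0 := by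
  rw [iteratedFDeriv_const_mul_archERho_mul_unit_apply]
  refine mul_eq_zero_of_right _ (Finset.prod_eq_zero (Finset.mem_univ i) ?_)
  have hC : (bzCayVec (u i) : W → Fin 3 → ℝ) = Pi.single w₀ (Pi.single 0 1) := by rw [hi]; rfl
  rw [hC, phase_single, if_pos hw₀]
  simp

end Match

end Literature.NumberTheory.Rogawski1990

end
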